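import Summits.ResolutionOfSingularities.ResolutionOfSingularities.Theorems.MarkedTransferCampaignW46MohWindowShadeFormalInsepCore
import Summits.ResolutionOfSingularities.ResolutionOfSingularities.Theorems.MarkedTransferCampaignW46MohWindowShadeFormalStepZChart
import HarnessLib

/-!
# [OURS · L1 W4.6 rung (iii-2), FORMAL ENTRANCE DOOR for POWER-SERIES residuals, brick 2b] The origin of the `z`-chart over a series-anchored
# point is never singular (ring level)

Cell `res-hironaka`, LADDER-RESOLUTION rung L (D-0089), slot W4.6 rung (iii); seat res-L1-s46-pv-6 (gen 6). Host route MarkedTransfer,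
`--supports stmt-ResolutionOfSingularities-16155 --as helper`; kind proof (no definition). Series twin of gen 5's `…FormalStepZChart`
(p530311): the same proof, the anchor `E₀(f₀) = w₀ · (z^p + F(u))` now with `F ∈ K⟦u⟧` ANY power series of order `≥ p`; the factorisation
`F(z·u) = z^p · m`, `m ∈ 𝔪`, is brick 0's `exists_subst_rename_eq_X_pow_mul_of_le_order`. OURS; NOT a statement of the manuscript
[claim: Hironaka2017, status: under-review], nothing of which is used. AI review is weaker than expert review. References: H. Matsumura,
*Commutative Ring Theory* (1986), Thm. 8.11. [Matsumura1987] [folklore]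
-/

noncomputable section

set_option linter.dupNamespace false -- mandated namespace of this single-conjunct summit

open IsLocalRing MvPolynomial

namespace Summit.ResolutionOfSingularities.ResolutionOfSingularities.Theorems

namespace CampaignW46

namespace MohWindowShadeFormalInsep

open Literature.AlgebraicGeometry.Resolution
open Literature.AlgebraicGeometry.Resolution.PointBlowup
open Literature.AlgebraicGeometry.Resolution.Hauser2010
open CampaignW46.FormalChart
open CampaignW46.AtomGerm (hasSubst_chartGerm ringHom_eq_subst_chartGerm rename_chartSubst_self rename_chartSubst_of_ne
  exists_isUnit_image_adapted X_some_ne_zero kill_rename_some constantCoeff_rename_some mem_maximalIdeal_pow_iff_algebraMap)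
open Literature.RingTheory.MvPowerSeries.Jets (mem_maximalIdeal_iff_constantCoeff_eq_zero)


section ZChart

variable {p : ℕ} [hp : Fact p.Prime] {K : Type} [Field K]
  {R : Type} [CommRing R] [IsLocalRing R] [IsNoetherianRing R]
  {L : Type} [CommRing L] [IsLocalRing L] [IsNoetherianRing L]
  (g : R →+* L) (hg : (maximalIdeal R).map g ≤ maximalIdeal L)
  (E₀ : AdicCompletion (maximalIdeal R) R ≃+* MvPowerSeries (Option (Fin 2)) K)
  (c : Option (Fin 2) → R) (hc : Ideal.span (Set.range c) = maximalIdeal R)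
  (hcX : ∀ j, E₀ (algebraMap R (AdicCompletion (maximalIdeal R) R) (c j)) - MvPowerSeries.X j ∈
    maximalIdeal (MvPowerSeries (Option (Fin 2)) K) ^ 2)
  (e : Option (Fin 2) → L) (he : ∀ j, g (c j) = g (c none) * e j)
  (τ : Option (Fin 2) → R)
  (hgen : Ideal.span (Set.range fun j : Option (Fin 2) =>
    if j = none then g (c none) else e j - g (τ j)) = maximalIdeal L)
  (hres : ∀ y : L, ∃ r : R, y - g r ∈ maximalIdeal L)
  (hdim : (Fintype.card (Option (Fin 2)) : WithBot ℕ∞) ≤ ringKrullDim L)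

include hg hc he hcX hgen hres hdim in
/-- [OURS · L1 W4.6 rung (iii-2) — FORMAL ENTRANCE DOOR for power-series residuals; NOT a statement of the manuscript] **The ORIGIN of the
`z`-chart over a SERIES-anchored point is not singular** (series twin of gen 5's `not_mem_maximalIdeal_transform_of_zChart`, the anchor
`z^p + F(u)` with `F` ANY power series of order `≥ p`): if the point upstairs lies in the chart of the fibre variable `z` with all `u`-coordinates `τ_{u_j} ∈ 𝔪`
(the origin of that chart), then the controlled transform `f′` of `f₀`, `E₀(f₀) = w₀ · (z^p + F(u))` with all monomials of `F` of degree
`≥ p`, is a UNIT: in Cohen coordinates the total transform is `z^p · (unit)` because `F(z·u) ∈ z^p · 𝔪`. So a singular point over an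
anchored point is always read in a `u`-chart. (Pattern of res-L1-s46-pv-2's `not_mem_maximalIdeal_transform_of_zChart`.)
[cite: Matsumura1987, Thm. 8.11] [folklore] -/
theorem not_mem_maximalIdeal_transform_of_zChart_series (hτ𝔪 : ∀ j : Fin 2, τ (some j) ∈ maximalIdeal R)
    (F : MvPowerSeries (Fin 2) K) (hF : (p : ℕ∞) ≤ F.order) (f₀ : R)
    (w₀ : MvPowerSeries (Option (Fin 2)) K) (hw₀ : IsUnit w₀)
    (hf₀ : E₀ (algebraMap R (AdicCompletion (maximalIdeal R) R) f₀) =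
      w₀ * (MvPowerSeries.X none ^ p + MvPowerSeries.rename (some : Fin 2 → Option (Fin 2)) F))
    (f' : L) (hf' : g f₀ = g (c none) ^ p * f') : f' ∉ maximalIdeal L := by
  classical
  intro hf'𝔪
  set ĝ := adicCompletionMap (maximalIdeal R) (maximalIdeal L) g hg with hĝ
  set φ : MvPowerSeries (Option (Fin 2)) K →+* AdicCompletion (maximalIdeal L) L := ĝ.comp E₀.symm.toRingHom with hφ
  set ofL := algebraMap L (AdicCompletion (maximalIdeal L) L) with hofL
  set ofR := algebraMap R (AdicCompletion (maximalIdeal R) R) with hofR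
  have hφE₀ : ∀ x, φ (E₀ x) = ĝ x := fun x => by
    rw [hφ, RingHom.comp_apply]
    change ĝ (E₀.symm (E₀ x)) = ĝ x
    rw [RingEquiv.symm_apply_apply]
  have hĝ_of : ∀ x : R, ĝ (ofR x) = ofL (g x) := fun x => by
    rw [hofR, hofL, hĝ, adicCompletionMap_algebraMap]
  haveI : IsNoetherianRing (AdicCompletion (maximalIdeal L) L) := isNoetherianRing_adicCompletion_maximalIdeal L
  -- the plain chart at the origin of the `z`-chart: all constants `τ_j(0)` vanish
  obtain ⟨E, hEC, hEi, hEj⟩ := exists_ringEquiv_completion_chart g hg E₀ c hc hcX none e he τ hgen hres hdim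
  have hτ0 : ∀ j : Fin 2, MvPowerSeries.constantCoeff (E₀ (ofR (τ (some j)))) = 0 := fun j =>
    mem_maximalIdeal_iff_constantCoeff_eq_zero.mp (ringEquiv_mem_maximalIdeal E₀
      (by rw [AdicCompletion.maximalIdeal_eq_map]; exact Ideal.mem_map_of_mem _ (hτ𝔪 j)))
  set σ : Option (Fin 2) → MvPowerSeries (Option (Fin 2)) K := fun j =>
    if j = none then MvPowerSeries.X none else MvPowerSeries.X none * (MvPowerSeries.X j + MvPowerSeries.C ((fun _ => (0 : K)) j))
    with hσ
  have hσsub : MvPowerSeries.HasSubst σ := hasSubst_chart none (fun _ => (0 : K))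
  set ψ : MvPowerSeries (Option (Fin 2)) K →+* MvPowerSeries (Option (Fin 2)) K := (E : _ →+* _).comp φ with hψ
  have hψapp : ∀ x, ψ x = E (φ x) := fun x => rfl
  have hψsubst : ∀ f, ψ f = MvPowerSeries.subst σ f := by
    intro f
    refine ringHom_eq_subst_of_apply_X ψ hEC none (fun _ => (0 : K)) hEi (fun j hj => ?_) f
    rw [hψapp, hEj j hj]
    cases j with
    | none => exact absurd rfl hj
    | some k => rw [hτ0 k]
  have hσnone : σ none = MvPowerSeries.X none := by rw [hσ]; simp
  have hσl : ∀ l : Fin 2, σ (some l) = MvPowerSeries.X none * MvPowerSeries.X (some l) := by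
    intro l; rw [hσ]; simp
  have hσX : ∀ j, σ j ∈ Ideal.span {(MvPowerSeries.X none : MvPowerSeries (Option (Fin 2)) K)} := by
    intro j
    cases j with
    | none => rw [hσnone]; exact Ideal.subset_span rfl
    | some l => rw [hσl l]; exact Ideal.mul_mem_right _ _ (Ideal.subset_span rfl)
  -- `ψ(F(u)) = z^p · m`, `m ∈ 𝔪`
  obtain ⟨m, hm, hψFeq⟩ := exists_subst_rename_eq_X_pow_mul_of_le_order p hσsub hσl hp.out.pos F hF
  have hψF : ψ (MvPowerSeries.rename (some : Fin 2 → Option (Fin 2)) F) = MvPowerSeries.X none ^ p * m := by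
    rw [hψsubst, hψFeq]
  -- the total transform: `E (g f₀) = ψ(w₀) · z^p · (1 + m)`
  have hEgf₀ : E (ofL (g f₀)) = ψ w₀ * (MvPowerSeries.X none ^ p * (1 + m)) := by
    rw [← hĝ_of, ← hφE₀, ← hψapp, hf₀, map_mul, map_add, map_pow, hψF, hψsubst (MvPowerSeries.X none),
      MvPowerSeries.subst_X hσsub, hσnone]
    ring
  -- `E (g c_none) = z · unit`
  obtain ⟨w₁, hw₁, hEc⟩ : ∃ w₁ : MvPowerSeries (Option (Fin 2)) K, IsUnit w₁ ∧
      E (ofL (g (c none))) = MvPowerSeries.X none * w₁ := by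
    obtain ⟨bb, hbb⟩ := Ideal.mem_span_singleton'.1
      (AtomGerm.subst_mem_span_pow_of_mem_maximalIdeal_pow hσsub hσX (hcX none))
    refine ⟨1 + MvPowerSeries.X none * bb, ?_, ?_⟩
    · rw [MvPowerSeries.isUnit_iff_constantCoeff, map_add, map_one, map_mul, MvPowerSeries.constantCoeff_X (R := K), zero_mul, add_zero]
      exact isUnit_one
    · rw [← hĝ_of, ← hφE₀, ← hψapp, hψsubst]
      have h1 : MvPowerSeries.subst σ (E₀ (ofR (c none))) =
          MvPowerSeries.subst σ (E₀ (ofR (c none)) - MvPowerSeries.X none) +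
            MvPowerSeries.subst σ (MvPowerSeries.X none : MvPowerSeries (Option (Fin 2)) K) := by
        rw [← MvPowerSeries.substAlgHom_apply hσsub, ← MvPowerSeries.substAlgHom_apply hσsub, ← MvPowerSeries.substAlgHom_apply hσsub,
          ← map_add, sub_add_cancel]
      rw [h1, ← hbb, MvPowerSeries.subst_X hσsub, hσnone]; ring
  -- cancel `z^p`: `w₁^p · E f′ = ψ(w₀) · (1 + m)` is a unit
  have hEf' : w₁ ^ p * E (ofL f') = ψ w₀ * (1 + m) := by
    have h1 : E (ofL (g f₀)) = (MvPowerSeries.X none * w₁) ^ p * E (ofL f') := by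
      rw [hf', map_mul, map_pow, map_mul, map_pow, hEc]
    have h2 : (MvPowerSeries.X none : MvPowerSeries (Option (Fin 2)) K) ^ p * (w₁ ^ p * E (ofL f')) =
        MvPowerSeries.X none ^ p * (ψ w₀ * (1 + m)) := by
      rw [← mul_assoc, ← mul_pow, ← h1, hEgf₀]; ring
    refine mul_left_cancel₀ (pow_ne_zero p ?_) h2
    intro h
    have := congrArg (MvPowerSeries.coeff (Finsupp.single (none : Option (Fin 2)) 1)) h
    rw [MvPowerSeries.coeff_index_single_self_X, map_zero] at this
    exact one_ne_zero this
  have hunit : IsUnit (E (ofL f')) := by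
    have h1m : IsUnit (1 + m) := by
      rw [MvPowerSeries.isUnit_iff_constantCoeff, map_add, map_one, mem_maximalIdeal_iff_constantCoeff_eq_zero.mp hm, add_zero]
      exact isUnit_one
    have hu : IsUnit (w₁ ^ p * E (ofL f')) := by rw [hEf']; exact (hw₀.map ψ).mul h1m
    exact isUnit_of_mul_isUnit_right hu
  -- but `f′ ∈ 𝔪_L` makes `E f′ ∈ 𝔪`
  have hmem : E (ofL f') ∈ maximalIdeal (MvPowerSeries (Option (Fin 2)) K) := by
    refine ringEquiv_mem_maximalIdeal E ?_
    rw [AdicCompletion.maximalIdeal_eq_map]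
    exact Ideal.mem_map_of_mem _ hf'𝔪
  exact (IsLocalRing.mem_maximalIdeal _).mp hmem hunit

end ZChart

end MohWindowShadeFormalInsep

end CampaignW46

end Summit.ResolutionOfSingularities.ResolutionOfSingularities.Theorems

end
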